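import Literature.MathematicalPhysics.QuantumFieldTheory.Balaban1983to89.T4CouplingMatching
import Literature.MathematicalPhysics.QuantumFieldTheory.Balaban1983to89.B5QGQ199Rate

/-!
# Spine/NE4/BalabanPhiZoneRate — (R61) CROSS-ROW RECONCILIATION: the printed (1.84) symbol `φ_μ(p′)` has NE4's shape and the (AF-0r) shape at rate
# `θ = L⁻²` at EVERY momentum of the punctured Brillouin zone and for EVERY component — BY IMPORT of the pub-balaban NE2 lineage's `B5QGQ199Rate.phiMu_rate`
# (King's exponent `n⁻²`), and the continuum symbol `φ_μ^{(∞)}(p′)` named with its rate `a·C_φ·n⁻²` (companion `BalabanPhiZoneRateAxis`: by (R60) the exponent is SHARP)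

Cell `pub-balaban-gaps` (YM blitz G2), seat `ne4`, generation 17 (unit `pub-balaban-gaps-ne4-g17`); record `HOME/ne/NE4.md` §5 (R61).

HONEST FRAMING.  NE4 = `T4CouplingMatching.ScaleShiftRate` is NOT IN PRINT ([Balaban1987RG1] = CMP **109** (1987) p. 264) and NOT proved; nothing below is about
Bałaban's β-functions, renormalization transformations or theorems.  This file RECONCILES this row's census with the tree: generation 16 booked «general off-axis
p′» for the η-dependence of the PRINTED symbol `φ_μ(p′)` of [Balaban1984PropagatorsI] (1.84) p. 31 (tree `B5Prop11Leaves.phiMu`) as UNTRIED next to its exact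
on-axis identity (R60) — but the η-RATE of (1.84) at EVERY momentum `p′ ≠ 0` of the zone, every component `μ`, every `d`, is ALREADY A THEOREM OF THE TREE:
`Literature/…/B5QGQ199Rate.phiMu_rate` (cell pub-balaban, spine estimate NE2 = node U1a «η-rate of the LINEAR theory», seat P1, generation 2; from generation 1's
`B5ActionRate166.phi162_rate`, King's Lemma 4.3 shape via the composition law `phi162_mul`): `|φ_μ^{(N)}(p′) − φ_μ^{(RN)}(p′)| ≤ a·C_φ·N⁻²`,
`C_φ = π²∕12 + 1∕3`, all `N, R ≥ 1` — the mechanism is King's [King1986] §4 ((4.29)–(4.31) p. 673, PRINTED for the scalar U(1)-Higgs averaging), the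
packaging and constants are that lineage's.  Here, with NO new analysis: (§1) that rate at the depths `L^k ≤ L^j` and along ALL depths `n, m` (common multiple);
(§2) the CONTINUUM SYMBOL `phiMuInf a μ p′ := lim_n φ_μ^{(n)}(p′)` (Cauchy, complete `ℝ`) with `|φ_μ^{(n)} − φ_μ^{(∞)}| ≤ a·C_φ·n⁻²` — the scalar analogue of this limit
is the Bell–Wilson ∕ «perfect» propagator symbol printed as an alias series over `ℤ^d` (W. Bietenholz, U.-J. Wiese, *Uncovering Quantum Field Theory and the Standard
Model*, CUP 2025, (5.20)–(5.23) p. 127: «In the limit ν → ∞, one may expect to approach a fixed point», NO rate printed there); (§3) THIS ROW's two currencies for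
the printed symbol at EVERY momentum: the β sub-cell's (AF-0r) field shape `∀ k, |φ^{(L^k)} − φ^{(∞)}| ≤ c₀θ^k` and NE4's own `ScaleShiftRate (a·C_φ·L⁻²) (L⁻²) γ`
for the history-free family `k ↦ φ_μ^{(L^k)}(p′)`, `θ = L⁻²`.  COMPANION (same generation, files after this one): `Spine/NE4/BalabanPhiZoneRateAxis` — by (R60) (`BalabanPhiAxis.phiMu_axis_eq`) the limit on the axis is
IDENTIFIED, `φ_μ^{(∞)}(q·e_ι) = 1 + a(2 + cos q)∕(12 sin²(q∕2))` (`μ ≠ ι`), and `n²·(φ_μ^{(n)} − φ_μ^{(∞)})(q·e_ι) = a∕6` for EVERY `n ≥ 1`: King's exponent `2` in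
`phiMu_rate` cannot be raised, and its constant `C_φ ≈ 1.156` is within the factor `6·C_φ ≈ 6.9` of the sharp axis value `1∕6`.
No status word moves: NE4 stays DEPENDENT; NE2 (the η-rate of the linear `U = 1` layer) is that lineage's row; spine 0∕9.  One finite T⁴; NOT ℝ⁴, NOT infinite
volume, NOT a mass gap, NOT Clay.
-/

noncomputable section

namespace Summit.QuantumFields.BalabanUV.T4Continuum.Spine.NE4

open Real Filter Topology
open Literature.MathematicalPhysics.QuantumFieldTheory.Balaban1983to89.B5Prop11Leaves (phiMu)
open Literature.MathematicalPhysics.QuantumFieldTheory.Balaban1983to89.B5ActionRate166 (Cphi Cphi_pos)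
open Literature.MathematicalPhysics.QuantumFieldTheory.Balaban1983to89.B5QGQ199Rate (phiMu_rate)
open Literature.MathematicalPhysics.QuantumFieldTheory.Balaban1983to89.FlowStep (ofMarkov)
open Literature.MathematicalPhysics.QuantumFieldTheory.Balaban1983to89.T4CouplingMatching (ScaleShiftRate scaleShiftRate_ofMarkov_iff)

namespace BalabanPhiZone

variable {d : ℕ}

/-! ## §1 The NE2 lineage's rate of (1.84), at any two depths -/

section Depths

/-- [bookkeeping] `φ_μ` does not depend on the `NeZero` witness: equal depths give equal symbols. [folklore] -/
theorem phiMu_congr {n m : ℕ} [NeZero n] [NeZero m] (h : n = m) (a : ℝ) (μ : Fin d) (s : Fin d → ℝ) :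
    phiMu n a μ s = phiMu m a μ s := by
  subst h
  rfl

/-- **THE NE2 LINEAGE's RATE, DEPTH `N` AGAINST ANY MULTIPLE `M = R·N`** (restated with the multiple as a free index): for `0 ≤ a`, `p′` in the punctured zone
(`|p′_κ| ≤ π`, `p′_{ν₀} ≠ 0`), `1 ≤ N`, `N ∣ M`, `1 ≤ M`: `|φ_μ^{(N)}(p′) − φ_μ^{(M)}(p′)| ≤ a·C_φ·N⁻²` (`B5QGQ199Rate.phiMu_rate`). [folklore] -/
theorem abs_phiMu_sub_phiMu_le_of_dvd {N M : ℕ} [NeZero N] [NeZero M] (hN : 1 ≤ N) (hNM : N ∣ M) (hM : 1 ≤ M) {a : ℝ} (ha : 0 ≤ a)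
    (μ : Fin d) {s : Fin d → ℝ} (hs : ∀ κ, |s κ| ≤ π) (ν₀ : Fin d) (hν₀ : s ν₀ ≠ 0) :
    |phiMu N a μ s - phiMu M a μ s| ≤ a * (Cphi * ((N : ℝ) ^ 2)⁻¹) := by
  obtain ⟨R, hR⟩ := hNM
  have hR1 : 1 ≤ R := by
    rcases Nat.eq_zero_or_pos R with h0 | hpos
    · subst h0; simp at hR; omega
    · exact hpos
  haveI : NeZero R := ⟨by omega⟩
  have h := phiMu_rate (N := N) (R := R) hN hR1 a ha μ s hs ν₀ hν₀
  have hRN : R * N = M := by rw [hR, mul_comm]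
  haveI : NeZero (R * N) := ⟨by rw [hRN]; exact NeZero.ne M⟩
  rwa [phiMu_congr hRN a μ s] at h

/-- **ANY TWO DEPTHS** (through the common multiple `n·m`): `|φ_μ^{(n)}(p′) − φ_μ^{(m)}(p′)| ≤ a·C_φ·(n⁻² + m⁻²)` for all `n, m ≥ 1`. [folklore] -/
theorem abs_phiMu_sub_phiMu_le {n m : ℕ} [NeZero n] [NeZero m] (hn : 1 ≤ n) (hm : 1 ≤ m) {a : ℝ} (ha : 0 ≤ a)
    (μ : Fin d) {s : Fin d → ℝ} (hs : ∀ κ, |s κ| ≤ π) (ν₀ : Fin d) (hν₀ : s ν₀ ≠ 0) :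
    |phiMu n a μ s - phiMu m a μ s| ≤ a * (Cphi * (((n : ℝ) ^ 2)⁻¹ + ((m : ℝ) ^ 2)⁻¹)) := by
  haveI : NeZero (n * m) := ⟨Nat.mul_ne_zero (by omega) (by omega)⟩
  have hnm : 1 ≤ n * m := Nat.one_le_iff_ne_zero.mpr (Nat.mul_ne_zero (by omega) (by omega))
  have h1 := abs_phiMu_sub_phiMu_le_of_dvd hn (Dvd.intro m rfl) hnm ha μ hs ν₀ hν₀
  have h2 := abs_phiMu_sub_phiMu_le_of_dvd hm (Dvd.intro_left n rfl) hnm ha μ hs ν₀ hν₀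
  calc |phiMu n a μ s - phiMu m a μ s|
      = |(phiMu n a μ s - phiMu (n * m) a μ s) - (phiMu m a μ s - phiMu (n * m) a μ s)| := by ring_nf
    _ ≤ |phiMu n a μ s - phiMu (n * m) a μ s| + |phiMu m a μ s - phiMu (n * m) a μ s| := abs_sub _ _
    _ ≤ a * (Cphi * ((n : ℝ) ^ 2)⁻¹) + a * (Cphi * ((m : ℝ) ^ 2)⁻¹) := add_le_add h1 h2
    _ = a * (Cphi * (((n : ℝ) ^ 2)⁻¹ + ((m : ℝ) ^ 2)⁻¹)) := by ring

/-- **AT THE DEPTHS `L^k ≤ L^j`**: `|φ_μ^{(L^j)}(p′) − φ_μ^{(L^k)}(p′)| ≤ a·C_φ·(L⁻²)^k` (`1 ≤ L`, `k ≤ j`; `0 ≤ a`, punctured zone). [folklore] -/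
theorem abs_phiMu_pow_sub_pow_le {L : ℕ} [NeZero L] (hL : 1 ≤ L) {k j : ℕ} (hkj : k ≤ j) {a : ℝ} (ha : 0 ≤ a)
    (μ : Fin d) {s : Fin d → ℝ} (hs : ∀ κ, |s κ| ≤ π) (ν₀ : Fin d) (hν₀ : s ν₀ ≠ 0) :
    |phiMu (L ^ j) a μ s - phiMu (L ^ k) a μ s| ≤ a * Cphi * ((L : ℝ)⁻¹ ^ 2) ^ k := by
  have hdvd : L ^ k ∣ L ^ j := pow_dvd_pow L hkj
  have h := abs_phiMu_sub_phiMu_le_of_dvd (Nat.one_le_pow k L hL) hdvd (Nat.one_le_pow j L hL) ha μ hs ν₀ hν₀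
  rw [abs_sub_comm] at h
  have hpow : ((L : ℝ)⁻¹ ^ 2) ^ k = ((((L ^ k : ℕ) : ℝ)) ^ 2)⁻¹ := by
    push_cast
    rw [← pow_mul, ← pow_mul, mul_comm 2 k, inv_pow]
  rw [hpow]
  linarith

end Depths

/-! ## §2 The continuum symbol `φ_μ^{(∞)}(p′)` and its rate -/

section Continuum

/-- THE SEQUENCE OF PRINTED SYMBOLS indexed by all depths: `phiMuSeq a μ p′ n := φ_μ^{(n+1)}(p′)`. [folklore] -/
def phiMuSeq (a : ℝ) (μ : Fin d) (s : Fin d → ℝ) (n : ℕ) : ℝ := phiMu (n + 1) a μ s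

/-- **THE CONTINUUM SYMBOL** `φ_μ^{(∞)}(p′) := lim_{n → ∞} φ_μ^{(n)}(p′)` (as `limUnder`; it IS the limit on the punctured zone by `tendsto_phiMuSeq`).  Its scalar
analogue is the Bell–Wilson «perfect» propagator symbol (an alias series over `ℤ^d`); no closed form is claimed here off the axis. [folklore] -/
def phiMuInf (a : ℝ) (μ : Fin d) (s : Fin d → ℝ) : ℝ := limUnder atTop (phiMuSeq a μ s)

/-- [bookkeeping] The sequence is Cauchy on the punctured zone (`|φ^{(n)} − φ^{(m)}| ≤ a·C_φ(n⁻² + m⁻²)`). [folklore] -/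
theorem cauchySeq_phiMuSeq {a : ℝ} (ha : 0 ≤ a) (μ : Fin d) {s : Fin d → ℝ} (hs : ∀ κ, |s κ| ≤ π) (ν₀ : Fin d) (hν₀ : s ν₀ ≠ 0) :
    CauchySeq (phiMuSeq a μ s) := by
  refine Metric.cauchySeq_iff'.2 fun ε hε => ?_
  obtain ⟨K, hK⟩ := exists_nat_gt (2 * a * Cphi / ε)
  refine ⟨K, fun n hn => ?_⟩
  rw [Real.dist_eq, phiMuSeq, phiMuSeq]
  have h := abs_phiMu_sub_phiMu_le (n := n + 1) (m := K + 1) (by omega) (by omega) ha μ hs ν₀ hν₀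
  have hcast1 : (((n + 1 : ℕ) : ℝ)) = (n : ℝ) + 1 := by push_cast; ring
  have hcast2 : (((K + 1 : ℕ) : ℝ)) = (K : ℝ) + 1 := by push_cast; ring
  rw [hcast1, hcast2] at h
  have hC := Cphi_pos
  have hK1 : (0 : ℝ) < (K : ℝ) + 1 := by positivity
  have hnK : ((K : ℝ) + 1) ≤ (n : ℝ) + 1 := by exact_mod_cast Nat.succ_le_succ hn
  have hinvn : (((n : ℝ) + 1) ^ 2)⁻¹ ≤ (((K : ℝ) + 1) ^ 2)⁻¹ := inv_anti₀ (by positivity) (by nlinarith)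
  -- `2aC/(K+1)² < ε` because `K + 1 > 2aC/ε` and `K + 1 ≥ 1`
  have hlt : 2 * a * Cphi * (((K : ℝ) + 1) ^ 2)⁻¹ < ε := by
    have hKε : 2 * a * Cphi < ε * ((K : ℝ) + 1) := by
      have := (div_lt_iff₀ hε).1 (hK.trans (by linarith : (K : ℝ) < K + 1))
      linarith
    have hsq : ε * ((K : ℝ) + 1) ≤ ε * ((K : ℝ) + 1) ^ 2 := by
      have : ((K : ℝ) + 1) ≤ ((K : ℝ) + 1) ^ 2 := by nlinarith
      exact mul_le_mul_of_nonneg_left this hε.le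
    rw [← div_eq_mul_inv, div_lt_iff₀ (by positivity)]
    linarith
  calc |phiMu (n + 1) a μ s - phiMu (K + 1) a μ s|
      ≤ a * (Cphi * ((((n : ℝ) + 1) ^ 2)⁻¹ + (((K : ℝ) + 1) ^ 2)⁻¹)) := h
    _ ≤ a * (Cphi * ((((K : ℝ) + 1) ^ 2)⁻¹ + (((K : ℝ) + 1) ^ 2)⁻¹)) :=
        mul_le_mul_of_nonneg_left (mul_le_mul_of_nonneg_left (add_le_add_left hinvn _) hC.le) ha
    _ = 2 * a * Cphi * (((K : ℝ) + 1) ^ 2)⁻¹ := by ring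
    _ < ε := hlt

/-- **THE PRINTED SYMBOLS CONVERGE** to `φ_μ^{(∞)}(p′)` on the punctured zone. [folklore] -/
theorem tendsto_phiMuSeq {a : ℝ} (ha : 0 ≤ a) (μ : Fin d) {s : Fin d → ℝ} (hs : ∀ κ, |s κ| ≤ π) (ν₀ : Fin d) (hν₀ : s ν₀ ≠ 0) :
    Tendsto (phiMuSeq a μ s) atTop (𝓝 (phiMuInf a μ s)) :=
  (cauchySeq_phiMuSeq ha μ hs ν₀ hν₀).tendsto_limUnder

/-- **THE RATE OF THE CONTINUUM LIMIT, UNIFORMLY ON THE ZONE**: `|φ_μ^{(n)}(p′) − φ_μ^{(∞)}(p′)| ≤ a·C_φ·n⁻²` for every `n ≥ 1`, every `μ`, every `p′ ≠ 0` of the zone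
(`C_φ = π²∕12 + 1∕3`; the subsequence of multiples `n(m+1)` stays within `a·C_φ·n⁻²` of `φ^{(n)}` and converges to `φ^{(∞)}`). [folklore] -/
theorem abs_phiMu_sub_phiMuInf_le {n : ℕ} [NeZero n] (hn : 1 ≤ n) {a : ℝ} (ha : 0 ≤ a) (μ : Fin d) {s : Fin d → ℝ} (hs : ∀ κ, |s κ| ≤ π)
    (ν₀ : Fin d) (hν₀ : s ν₀ ≠ 0) :
    |phiMu n a μ s - phiMuInf a μ s| ≤ a * Cphi * ((n : ℝ) ^ 2)⁻¹ := by
  -- along the multiples `n·(m+1) = (n·m + (n−1)) + 1`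
  have hsub : Tendsto (fun m : ℕ => phiMuSeq a μ s (n * m + (n - 1))) atTop (𝓝 (phiMuInf a μ s)) :=
    (tendsto_phiMuSeq ha μ hs ν₀ hν₀).comp
      (tendsto_atTop_mono (fun m => (Nat.le_mul_of_pos_left m hn).trans (Nat.le_add_right _ _)) tendsto_id)
  have hlim : Tendsto (fun m : ℕ => |phiMu n a μ s - phiMuSeq a μ s (n * m + (n - 1))|) atTop (𝓝 |phiMu n a μ s - phiMuInf a μ s|) :=
    (tendsto_const_nhds.sub hsub).abs
  refine le_of_tendsto' hlim fun m => ?_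
  have hidx : n * m + (n - 1) + 1 = n * (m + 1) := by
    have : 1 ≤ n := hn
    zify [this]
    ring
  haveI : NeZero (n * (m + 1)) := ⟨Nat.mul_ne_zero (by omega) (by omega)⟩
  rw [phiMuSeq, phiMu_congr hidx a μ s]
  have h := abs_phiMu_sub_phiMu_le_of_dvd hn (Dvd.intro (m + 1) rfl) (Nat.one_le_iff_ne_zero.mpr (NeZero.ne _)) ha μ hs ν₀ hν₀
  linarith

end Continuum

/-! ## §3 This row's two currencies for the printed symbol, at every momentum of the punctured zone -/

section Shapes

/-- **THE (AF-0r) FIELD SHAPE FOR THE PRINTED (1.84) AT EVERY MOMENTUM** — VERBATIM the β sub-cell's `Beta.Assembly.LimitForm.conv : ∀ k, |S.β0 k − binf| ≤ c₀·θ^k` for the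
sequence `k ↦ φ_μ^{(L^k)}(p′)`: limit `φ_μ^{(∞)}(p′)`, `c₀ = a·C_φ`, `θ = L⁻²` (`1 ≤ L`; `0 ≤ a`; `p′ ≠ 0` in the zone; every `μ`, every `d`).  An instance of the SHAPE on a
printed `U = 1` symbol; NOT Bałaban's `β⁰`. [folklore] -/
theorem conv_phiMu_pow {L : ℕ} [NeZero L] (hL : 1 ≤ L) {a : ℝ} (ha : 0 ≤ a) (μ : Fin d) {s : Fin d → ℝ} (hs : ∀ κ, |s κ| ≤ π) (ν₀ : Fin d) (hν₀ : s ν₀ ≠ 0)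
    (k : ℕ) : |phiMu (L ^ k) a μ s - phiMuInf a μ s| ≤ (a * Cphi) * ((L : ℝ)⁻¹ ^ 2) ^ k := by
  have h := abs_phiMu_sub_phiMuInf_le (Nat.one_le_pow k L hL) ha μ hs ν₀ hν₀
  have hpow : ((L : ℝ)⁻¹ ^ 2) ^ k = ((((L ^ k : ℕ) : ℝ)) ^ 2)⁻¹ := by
    push_cast
    rw [← pow_mul, ← pow_mul, mul_comm 2 k, inv_pow]
  rwa [hpow]

/-- The same packaged as the existential (AF-0r) shape with `0 ≤ c₀`, `0 ≤ θ < 1` (`2 ≤ L`). [folklore] -/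
theorem conv_shape_phiMu {L : ℕ} [NeZero L] (hL : 2 ≤ L) {a : ℝ} (ha : 0 ≤ a) (μ : Fin d) {s : Fin d → ℝ} (hs : ∀ κ, |s κ| ≤ π) (ν₀ : Fin d) (hν₀ : s ν₀ ≠ 0) :
    ∃ binf c₀ θ : ℝ, 0 ≤ c₀ ∧ 0 ≤ θ ∧ θ < 1 ∧ ∀ k, |phiMu (L ^ k) a μ s - binf| ≤ c₀ * θ ^ k := by
  have hL1 : (1 : ℝ) < L := by exact_mod_cast hL
  refine ⟨phiMuInf a μ s, a * Cphi, (L : ℝ)⁻¹ ^ 2, mul_nonneg ha Cphi_pos.le, by positivity, ?_, conv_phiMu_pow (by omega) ha μ hs ν₀ hν₀⟩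
  have h1 : (L : ℝ)⁻¹ < 1 := inv_lt_one_of_one_lt₀ hL1
  have h0 : 0 ≤ (L : ℝ)⁻¹ := inv_nonneg.2 (by linarith)
  nlinarith

/-- **NE4's OWN SHAPE FOR THE PRINTED (1.84) AT EVERY MOMENTUM**: the history-free family `β_{k+1} := φ_μ^{(L^{k+1})}(p′)` satisfies
`T4CouplingMatching.ScaleShiftRate (a·C_φ·L⁻²) (L⁻²) γ (ofMarkov …)` for every box `γ` (`1 ≤ L`; `0 ≤ a`; `p′ ≠ 0` in the zone; every `μ`, `d`) — the (R59)∕(R60) statements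
(`scaleShiftRate_blockCov`, `phiMu_axis_step`: EXACT, on the axis, transverse `μ`) now at every momentum and component as a BOUND, by the NE2 lineage's theorem.  An instance
of the SHAPE; NOT Bałaban's β. [folklore] -/
theorem scaleShiftRate_phiMu {L : ℕ} [NeZero L] (hL : 1 ≤ L) {a : ℝ} (ha : 0 ≤ a) (μ : Fin d) {s : Fin d → ℝ} (hs : ∀ κ, |s κ| ≤ π) (ν₀ : Fin d) (hν₀ : s ν₀ ≠ 0)
    (γ : ℝ) : ScaleShiftRate (a * Cphi * (L : ℝ)⁻¹ ^ 2) ((L : ℝ)⁻¹ ^ 2) γ (ofMarkov fun k _ => phiMu (L ^ k) a μ s) := by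
  rw [scaleShiftRate_ofMarkov_iff]
  intro k g _ _
  have h := abs_phiMu_pow_sub_pow_le hL (Nat.le_succ (k + 1)) ha μ hs ν₀ hν₀
  calc |phiMu (L ^ (k + 2)) a μ s - phiMu (L ^ (k + 1)) a μ s|
      ≤ a * Cphi * ((L : ℝ)⁻¹ ^ 2) ^ (k + 1) := h
    _ = a * Cphi * (L : ℝ)⁻¹ ^ 2 * ((L : ℝ)⁻¹ ^ 2) ^ k := by rw [pow_succ]; ring

end Shapes

end BalabanPhiZone

end Summit.QuantumFields.BalabanUV.T4Continuum.Spine.NE4
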